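import Literature.MathematicalPhysics.QuantumFieldTheory.ContinuumLimitsTrivialityProofs
import Literature.Probability.LatticeModels.HighDimTriviality
import Literature.MathematicalPhysics.QuantumLattice.SchwartzTranslationCutoff
import Mathlib.MeasureTheory.Measure.LevyConvergence
import Mathlib.MeasureTheory.Measure.Portmanteau
import Mathlib.Analysis.LocallyConvex.WeakDual
import Mathlib.MeasureTheory.Measure.CharacteristicFunction.TaylorExpansion
import HarnessLib

/-!
# The Gaussian-limit assembly for constructive-qft.S24 (`phi44_triviality`): laws on `𝒮'`

Sibling proofs file of `Literature/MathematicalPhysics/QuantumFieldTheory/ContinuumLimits.lean`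
(theorems only: no statement of that file is changed, no definition and no named fact is
introduced).

Aizenman–Duminil-Copin (Ann. Math. 194 (2021), arXiv:1912.07973) deduce their Thm 1.2
("any random field reachable by the above constructions … is a generalized Gaussian process",
`d = 4`) from the exponential-moment estimate Prop. 1.4 (Ising) / Prop. 7.2 (Griffiths–Simon
class, containing lattice `φ⁴`, p. 28) by the remark printed after Prop. 1.4 (p. 6): "The
claimed gaussianity follows since (by the Infrared Bound …) for any non-negative continuous
function `f ≢ 0` with bounded support, `C r_f² ‖f‖²_∞ ≥ ⟨T_{f,L}(σ)²⟩_β ≥ c_f > 0`, uniformly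
in `β ≤ β_c` and `L`, we get that for `L ≫ 1` the distribution of `T_{f,L}(σ)` is approximately
Gaussian of variance `⟨T_{f,L}(σ)²⟩_β`." This file proves that deduction once and for all, at
the level of laws on `𝒮'(ℝᵈ)` (`FieldConfig`, `TendstoInLaw`, Mathlib's
`ProbabilityTheory.IsGaussian`), in the generality needed by the law-level renderings of S24
(`phi44_triviality`, and equally `ising4_triviality`, `phi4_highDim_triviality`), where the
field normalisation `ρ(δ)` is arbitrary rather than the block-spin normalisation `Σ_L^{-1/2}` of
print and no a priori variance bound is available:

* `eq_gaussianReal_of_tendsto_of_mgf_approx` (real line): if probability laws `P_i → P₀`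
  weakly along a countably generated filter and the moment generating function of `P_i` is
  within `o(1)`, locally uniformly, of `exp(w² v_i/2)` with `v_i` *its own* second moment, then
  `v_i → v` and `P₀ = N(0, v)`. The point is that no bound on `v_i` is assumed: tightness of
  the convergent family bounds it (`eventually_variance_le_of_tendsto`: portmanteau plus the
  Paley–Zygmund inequality `sq_variance_le_fourth_mul_measure`, the fourth moment being
  controlled by the two exponential moments at `w = ±v_i^{-1/2}`, `integral_pow_four_le_of_exp`);
  then truncation (`tendsto_integral_of_tendsto_of_sq_le` of `HighDimTriviality`) gives
  convergence of all exponential moments and `eq_gaussianReal_of_mgf_eq` identifies the limit.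
* `map_eval_eq_gaussianReal_of_tendstoInLaw`: the same for the marginal `ω(f)` of a limit in law
  `ν_i → μ` on `𝒮'` (Lévy's continuity theorem on the rays `t • f`,
  `tendsto_marginal_of_tendstoInLaw`); `tendsto_integral_exp_eval_of_tendstoInLaw`,
  `tendsto_integral_sq_eval_of_tendstoInLaw`: exponential and second moments pass to limits in
  law under uniform bounds (the tool by which bounds printed for infinite-volume states reach
  thermodynamic limits in law of finite-volume laws).
* `map_eval_eq_gaussianReal_of_hasCompactSupport`: centred Gaussian marginals for compactly
  supported test functions (print: `f ∈ C_0`) give centred Gaussian marginals for all Schwartz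
  test functions (sequential density `exists_hasCompactSupport_tendsto` of
  `SchwartzTranslationCutoff`; the variances are forced to converge by continuity at `0` of the
  limiting characteristic function);
  `exists_strongDual_eq_eval` of `OSAxiomsFreeFieldExistenceProofs.lean` (the continuous linear
  functionals of `𝒮'` with its weak-* topology are the evaluations; Mathlib's weak representation
  theorem `LinearMap.dualEmbedding_surjective`; the local restatement
  `exists_eval_eq_of_strongDual` is deprecated) and `isGaussian_of_map_eval_eq_gaussianReal`:
  Gaussian marginals make `μ` Gaussian in Mathlib's sense.
* `isGaussian_of_tendstoInLaw_of_mgfApprox`: hence a limit in law of laws whose marginals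
  `ω(f)`, `f` compactly supported, have asymptotically Gaussian exponential moments in the above
  sense is Gaussian; `isGaussian_of_tendstoInLaw_of_scaleBound`: the same from a bound of the
  scale-covariant form `|∫ e^{w ω(f)} dν_i - e^{w² v_i/2}| ≤ K_i G(s_i w²)` (`G` monotone) plus a
  lower bound `c s_i ≤ ∫ ω(f₀)² dν_i` for one `f₀` — the shape in which Prop. 7.2 (in the form its
  proof gives, prefactor `e^{z²⟨T_{|f|,L}²⟩/2}`, cf. the caveat recorded at
  `Literature.Probability.LatticeModels.aizenmanDuminilCopin_mgf_normalizedField_bound`) and the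
  two variance bounds of p. 6 arrive under an unknown normalisation `s_i^{1/2}`
  (`eventually_scale_le_of_tendstoInLaw`: the scale is bounded, by the tightness argument at
  `w = ±v_i^{-1/2}`).
* `phi44_triviality_of_isGaussian` (the two-line centring reduction for the restated fact,
  through `isGaussianField_of_isGaussian_phi4_thermodynamicLimit`) and
  `phi44_triviality_of_scaleBound`: **`phi44_triviality` follows from the law-level transcription
  of ADC Prop. 7.2 with the variance bounds of p. 6** for the thermodynamic-limit laws `ν_δ` of
  the restated fact, inside its window; the a-posteriori hypothesis
  `HasBoundedNondegenerateTwoPoint μ` is not used.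

What is NOT here (and keeps `phi44_triviality_holds` open): the `φ⁴₄` substance of the source —
Prop. 7.2 itself (the improved tree diagram bound Thm 7.1 for the Griffiths–Simon class, random
currents, the regularity and infrared inputs of §5) and the variance bounds of p. 6, for the
infinite-volume lattice `φ⁴` state, identified with `ν_δ`. Under D-0026 these are not vendored
here as named facts; `phi44_triviality_of_scaleBound` states precisely what such a vendoring
has to supply.

## References

* M. Aizenman, H. Duminil-Copin, *Marginal triviality of the scaling limits of critical 4D Ising
  and `φ⁴₄` models*, Ann. Math. 194 (2021) 163–235, arXiv:1912.07973: Def. 1.1 and Thm 1.2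
  (p. 4), Prop. 1.4 and the display after it (p. 6), §6.3 (p. 26), Thm 7.1 and Prop. 7.2 (p. 28)
  [AizenmanDuminilCopinAnnals2021].
* J. Glimm, A. Jaffe, *Quantum Physics* (2nd ed. 1987), §6.1–6.2 (laws on `𝒮'`, generating
  functionals, Gaussian measures).
* P. Billingsley, *Convergence of Probability Measures* (2nd ed. 1999), §1–§5 (weak convergence,
  tightness, uniform integrability).

## Mathlib

`ProbabilityMeasure.tendsto_of_tendsto_charFun` (Lévy, sequences; extended to countably generated
filters by `Filter.tendsto_of_seq_tendsto`), `ProbabilityMeasure.limsup_measure_closed_le_of_tendsto`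
(portmanteau), `Measure.ext_of_charFun`, `charFun_gaussianReal`, `continuous_charFun`,
`isGaussian_of_map_eq_gaussianReal`, `LinearMap.dualEmbedding_surjective` with
`PointwiseConvergenceCLM.equivWeakDual`; from the tree `tendsto_integral_of_tendsto_of_sq_le`,
`eq_gaussianReal_of_mgf_eq` (`HighDimTriviality`), `exists_hasCompactSupport_tendsto`
(`SchwartzTranslationCutoff`), `isProbabilityMeasure_of_tendstoInLaw`,
`genFunctional_smul_eq_charFun_map`, `isGaussianField_of_isGaussian_phi4_thermodynamicLimit`
(`ContinuumLimitsTrivialityProofs`). Mathlib has no Paley–Zygmund inequality and no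
"convergence of moment generating functions identifies the limit" statement at the pin; both are
proved here in the form needed.
-/

noncomputable section

open scoped SchwartzMap NNReal
open MeasureTheory Filter Topology Complex ProbabilityTheory
open Literature.MathematicalPhysics.QuantumLattice

namespace Literature.MathematicalPhysics.QuantumFieldTheory

/-! ### Real random variables: fourth moments, Paley–Zygmund, tightness, Gaussian limits -/

section RealLine

/-- `u⁴ ≤ 24 (e^u + e^{-u})` (the fourth-order term of the exponential series). [folklore] -/
theorem pow_four_le_exp_add_exp_neg (u : ℝ) :
    u ^ 4 ≤ 24 * (Real.exp u + Real.exp (-u)) := by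
  have h24 : ((4 : ℕ).factorial : ℝ) = 24 := by norm_num [Nat.factorial]
  rcases le_or_gt 0 u with hu | hu
  · have h := Real.pow_div_factorial_le_exp u hu 4
    rw [h24, div_le_iff₀ (by norm_num : (0 : ℝ) < 24)] at h
    nlinarith [Real.exp_pos (-u)]
  · have h := Real.pow_div_factorial_le_exp (-u) (neg_nonneg.mpr hu.le) 4
    rw [h24, div_le_iff₀ (by norm_num : (0 : ℝ) < 24)] at h
    have h' : (-u) ^ 4 = u ^ 4 := by ring
    rw [h'] at h
    nlinarith [Real.exp_pos u]

/-- **Fourth moment from two exponential moments.** If `e^{wx}` and `e^{-wx}` are integrable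
(`w ≠ 0`) then `x⁴` is integrable and `∫ x⁴ ≤ 24 w⁻⁴ (∫ e^{wx} + ∫ e^{-wx})`. [folklore] -/
theorem integral_pow_four_le_of_exp (P : Measure ℝ) {w : ℝ} (hw : w ≠ 0)
    (hp : Integrable (fun x : ℝ => Real.exp (w * x)) P)
    (hm : Integrable (fun x : ℝ => Real.exp (-w * x)) P) :
    Integrable (fun x : ℝ => x ^ 4) P ∧
      ∫ x, x ^ 4 ∂P ≤ 24 / w ^ 4 * (∫ x, Real.exp (w * x) ∂P + ∫ x, Real.exp (-w * x) ∂P) := by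
  have hw4 : 0 < w ^ 4 := by positivity
  have hpt : ∀ x : ℝ, x ^ 4 ≤ 24 / w ^ 4 * (Real.exp (w * x) + Real.exp (-w * x)) := by
    intro x
    have h := pow_four_le_exp_add_exp_neg (w * x)
    rw [div_mul_eq_mul_div, le_div_iff₀ hw4]
    calc x ^ 4 * w ^ 4 = (w * x) ^ 4 := by ring
      _ ≤ 24 * (Real.exp (w * x) + Real.exp (-(w * x))) := h
      _ = 24 * (Real.exp (w * x) + Real.exp (-w * x)) := by rw [neg_mul]
  have hdom : Integrable (fun x : ℝ => 24 / w ^ 4 * (Real.exp (w * x) + Real.exp (-w * x))) P :=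
    (hp.add hm).const_mul _
  have hint : Integrable (fun x : ℝ => x ^ 4) P := by
    refine hdom.mono' (by fun_prop) (Eventually.of_forall fun x => ?_)
    rw [Real.norm_eq_abs, abs_of_nonneg (by positivity)]
    exact hpt x
  refine ⟨hint, ?_⟩
  calc ∫ x, x ^ 4 ∂P ≤ ∫ x, 24 / w ^ 4 * (Real.exp (w * x) + Real.exp (-w * x)) ∂P :=
        integral_mono hint hdom hpt
    _ = 24 / w ^ 4 * (∫ x, Real.exp (w * x) ∂P + ∫ x, Real.exp (-w * x) ∂P) := by
        rw [integral_const_mul, integral_add hp hm]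

/-- Square integrability from fourth-moment integrability under a finite measure
(`x² ≤ 1 + x⁴`). [folklore] -/
theorem integrable_sq_of_integrable_pow_four (P : Measure ℝ) [IsFiniteMeasure P]
    (h4 : Integrable (fun x : ℝ => x ^ 4) P) : Integrable (fun x : ℝ => x ^ 2) P := by
  have hg : Integrable (fun x : ℝ => 1 + x ^ 4) P := (integrable_const (1 : ℝ)).add h4
  refine hg.mono' (by fun_prop) (Eventually.of_forall fun x => ?_)
  rw [Real.norm_eq_abs, abs_of_nonneg (sq_nonneg x)]
  nlinarith [sq_nonneg (x ^ 2 - 1), sq_nonneg x]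

/-- **Paley–Zygmund inequality for the square** (second-moment method). For a probability law
`P` on `ℝ` with `v = ∫ x² dP > 0` and `m = ∫ x⁴ dP < ∞`,
`P(x² ≥ v/2) ≥ v²/(4m)`, written multiplicatively. [folklore] -/
theorem sq_variance_le_fourth_mul_measure (P : Measure ℝ) [IsProbabilityMeasure P]
    (h4 : Integrable (fun x : ℝ => x ^ 4) P) (hv : 0 < ∫ x, x ^ 2 ∂P) :
    (∫ x, x ^ 2 ∂P) ^ 2 ≤
      4 * (∫ x, x ^ 4 ∂P) * P.real {x : ℝ | (∫ y, y ^ 2 ∂P) / 2 ≤ x ^ 2} := by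
  set v : ℝ := ∫ x, x ^ 2 ∂P with hv_def
  set m : ℝ := ∫ x, x ^ 4 ∂P with hm_def
  set A : Set ℝ := {x : ℝ | v / 2 ≤ x ^ 2} with hA_def
  have hA : MeasurableSet A := measurableSet_le measurable_const (measurable_id.pow_const 2)
  have h2 : Integrable (fun x : ℝ => x ^ 2) P := integrable_sq_of_integrable_pow_four P h4
  have hm0 : 0 ≤ m := integral_nonneg fun x => by positivity
  have hPA1 : P.real A ≤ 1 := measureReal_le_one
  have hPA0 : 0 ≤ P.real A := measureReal_nonneg
  -- the basic inequality: for every `ε > 0`, `v/2 ≤ m/(4ε) + ε P(A)`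
  have key : ∀ ε : ℝ, 0 < ε → v / 2 ≤ m / (4 * ε) + ε * P.real A := by
    intro ε hε
    have hpt : ∀ x : ℝ, x ^ 2 ≤ v / 2 + (x ^ 4 / (4 * ε) + ε * A.indicator 1 x) := by
      intro x
      by_cases hx : x ∈ A
      · rw [Set.indicator_of_mem hx, Pi.one_apply, mul_one]
        have hamgm : x ^ 2 ≤ x ^ 4 / (4 * ε) + ε := by
          rw [div_add' _ _ _ (by positivity), le_div_iff₀ (by positivity)]
          nlinarith [sq_nonneg (x ^ 2 - 2 * ε)]
        have hv0 : 0 ≤ v / 2 := by linarith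
        linarith
      · rw [Set.indicator_of_notMem hx, mul_zero, add_zero]
        have hx' : x ^ 2 < v / 2 := by
          simpa [hA_def] using hx
        have : 0 ≤ x ^ 4 / (4 * ε) := by positivity
        linarith
    have hind : Integrable (fun x : ℝ => A.indicator (1 : ℝ → ℝ) x) P :=
      (integrable_const (1 : ℝ)).indicator hA
    have hrhs : Integrable (fun x : ℝ => v / 2 + (x ^ 4 / (4 * ε) + ε * A.indicator 1 x)) P :=
      (integrable_const _).add ((h4.div_const _).add (hind.const_mul _))
    have hI := integral_mono h2 hrhs hpt
    have hrhs_eq : ∫ x, v / 2 + (x ^ 4 / (4 * ε) + ε * A.indicator 1 x) ∂P =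
        v / 2 + (m / (4 * ε) + ε * P.real A) := by
      rw [integral_add (f := fun _ : ℝ => v / 2)
          (g := fun x : ℝ => x ^ 4 / (4 * ε) + ε * A.indicator 1 x) (integrable_const _)
          ((h4.div_const _).add (hind.const_mul _)),
        integral_add (f := fun x : ℝ => x ^ 4 / (4 * ε)) (g := fun x : ℝ => ε * A.indicator 1 x)
          (h4.div_const _) (hind.const_mul _),
        integral_const_mul, integral_indicator_one hA, integral_const, smul_eq_mul,
        integral_div, probReal_univ, one_mul]
    rw [hrhs_eq, ← hv_def] at hI
    linarith
  rcases hm0.eq_or_lt with hm | hm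
  · -- `m = 0`: then `v/2 ≤ ε` for every `ε`, contradicting `v > 0`
    exfalso
    have h := key (v / 4) (by linarith)
    rw [← hm, zero_div, zero_add] at h
    nlinarith
  · have h := key (m / v) (div_pos hm hv)
    have h1 : m / (4 * (m / v)) = v / 4 := by
      field_simp
    rw [h1] at h
    have h3 : v / 4 ≤ m / v * P.real A := by linarith
    rw [div_mul_eq_mul_div, le_div_iff₀ hv] at h3
    nlinarith

/-- **Tight families with bounded kurtosis have bounded variance.** Let probability laws
`P_i → P₀` weakly on `ℝ` along a filter `l`, and suppose that, eventually along `l`, whenever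
the second moment `v_i = ∫ x² dP_i` exceeds `V₀ > 0` the fourth moment is at most `B v_i²`.
Then `v_i` is eventually bounded: by Paley–Zygmund `P_i(x² ≥ v_i/2) ≥ 1/(4B)`, while by the
portmanteau theorem `P_i(|x| ≥ R) < 1/(4B)` eventually, for `R` large. [folklore] -/
theorem eventually_variance_le_of_tendsto {ι : Type*} {l : Filter ι}
    {P : ι → ProbabilityMeasure ℝ} {P₀ : ProbabilityMeasure ℝ} (hP : Tendsto P l (𝓝 P₀))
    {V₀ B : ℝ} (hV₀ : 0 < V₀)
    (h4 : ∀ᶠ i in l, V₀ ≤ ∫ x, x ^ 2 ∂(P i : Measure ℝ) →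
      Integrable (fun x : ℝ => x ^ 4) (P i : Measure ℝ) ∧
        ∫ x, x ^ 4 ∂(P i : Measure ℝ) ≤ B * (∫ x, x ^ 2 ∂(P i : Measure ℝ)) ^ 2) :
    ∃ V : ℝ, ∀ᶠ i in l, ∫ x, x ^ 2 ∂(P i : Measure ℝ) ≤ V := by
  set B' : ℝ := max B 1 with hB'_def
  have hB'pos : 0 < B' := lt_of_lt_of_le one_pos (le_max_right _ _)
  have hBB' : B ≤ B' := le_max_left _ _
  set p₀ : ℝ := 1 / (4 * B') with hp₀_def
  have hp₀ : 0 < p₀ := by positivity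
  -- closed sets `F R = {R ≤ |x|}` shrink to the empty set
  set F : ℕ → Set ℝ := fun R => {x : ℝ | (R : ℝ) ≤ |x|} with hF_def
  have hFclosed : ∀ R, IsClosed (F R) := fun R =>
    isClosed_le continuous_const continuous_abs
  have hFanti : Antitone F := fun R R' hRR' x (hx : (R' : ℝ) ≤ |x|) =>
    show (R : ℝ) ≤ |x| from le_trans (Nat.cast_le.mpr hRR') hx
  have hFempty : ⋂ R, F R = ∅ := by
    refine Set.eq_empty_of_forall_notMem fun x hx => ?_
    obtain ⟨R, hR⟩ := exists_nat_gt |x|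
    exact (lt_irrefl _ ((Set.mem_iInter.mp hx R).trans_lt hR))
  have hlim0 : Tendsto (fun R => (P₀ : Measure ℝ) (F R)) atTop (𝓝 0) := by
    have h := tendsto_measure_iInter_atTop (μ := (P₀ : Measure ℝ))
      (fun R => (hFclosed R).measurableSet.nullMeasurableSet) hFanti
      ⟨0, measure_ne_top _ _⟩
    rwa [hFempty, measure_empty] at h
  obtain ⟨R, hR⟩ : ∃ R : ℕ, (P₀ : Measure ℝ) (F R) < ENNReal.ofReal p₀ :=
    ((tendsto_order.1 hlim0).2 _ (by simpa using hp₀)).exists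
  -- portmanteau: eventually `P_i(F R) < p₀`
  have hev : ∀ᶠ i in l, (P i : Measure ℝ) (F R) < ENNReal.ofReal p₀ :=
    eventually_lt_of_limsup_lt
      ((ProbabilityMeasure.limsup_measure_closed_le_of_tendsto hP (hFclosed R)).trans_lt hR)
  refine ⟨max V₀ (2 * (R : ℝ) ^ 2), ?_⟩
  filter_upwards [h4, hev] with i h4i hlti
  by_contra hcon
  push Not at hcon
  set v : ℝ := ∫ x, x ^ 2 ∂(P i : Measure ℝ) with hv_def
  have hvV₀ : V₀ ≤ v := (le_max_left _ _).trans hcon.le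
  have hvpos : 0 < v := hV₀.trans_le hvV₀
  obtain ⟨hint4, hm⟩ := h4i hvV₀
  have hPZ := sq_variance_le_fourth_mul_measure (P i : Measure ℝ) hint4 hvpos
  rw [← hv_def] at hPZ
  set A : Set ℝ := {x : ℝ | v / 2 ≤ x ^ 2} with hA_def
  -- `A ⊆ F R`
  have hAF : A ⊆ F R := by
    intro x hx
    have hx2 : (R : ℝ) ^ 2 < x ^ 2 := by
      have : 2 * (R : ℝ) ^ 2 < v := (le_max_right _ _).trans_lt hcon
      have hx' : v / 2 ≤ x ^ 2 := hx
      linarith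
    have : (R : ℝ) < |x| := lt_of_pow_lt_pow_left₀ 2 (abs_nonneg x) (by rwa [sq_abs])
    exact this.le
  have hPA : (P i : Measure ℝ).real A < p₀ :=
    ENNReal.toReal_lt_of_lt_ofReal ((measure_mono hAF).trans_lt hlti)
  -- contradiction with Paley–Zygmund
  have h1 : v ^ 2 ≤ 4 * (B' * v ^ 2) * (P i : Measure ℝ).real A := by
    refine hPZ.trans ?_
    gcongr
    exact hm.trans (mul_le_mul_of_nonneg_right hBB' (sq_nonneg _))
  have h2 : 4 * B' * (P i : Measure ℝ).real A < 1 := by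
    rw [hp₀_def, lt_div_iff₀ (by positivity)] at hPA
    linarith
  have hv2 : 0 < v ^ 2 := by positivity
  nlinarith


/-- **Limits in law of asymptotically Gaussian variables are Gaussian** (one-dimensional
assembly step of Aizenman–Duminil-Copin 2021, p. 6: "for `L ≫ 1` the distribution of `T_{f,L}`
is approximately Gaussian of variance `⟨T_{f,L}²⟩`", made unconditional in the variance).
Let probability laws `P_i → P₀` weakly on `ℝ` along a countably generated filter, with all
exponential moments finite eventually, and suppose the moment generating function of `P_i` is
within `K_i → 0` of that of the centred Gaussian *with the same second moment* `v_i = ∫ x² dP_i`,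
locally uniformly in the argument `w`. Then `v_i` converges to some `v ≥ 0`, `P₀ = N(0, v)`, and
all exponential moments converge. No a priori bound on `v_i` is assumed: tightness of the
convergent family bounds it (`eventually_variance_le_of_tendsto`, the fourth moment being
controlled by the exponential moments at `w = ±v_i^{-1/2}`); then truncation gives convergence of
exponential moments (`tendsto_integral_of_tendsto_of_sq_le`), and a law whose moment generating
function is `exp(v w²/2)` is `N(0, v)` (`eq_gaussianReal_of_mgf_eq`).
[cite: AizenmanDuminilCopinAnnals2021, p. 6 (display after Prop. 1.4)] -/
theorem eq_gaussianReal_of_tendsto_of_mgf_approx {ι : Type*} {l : Filter ι} [l.NeBot]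
    [l.IsCountablyGenerated] {P : ι → ProbabilityMeasure ℝ} {P₀ : ProbabilityMeasure ℝ}
    (hP : Tendsto P l (𝓝 P₀))
    (hint : ∀ᶠ i in l, ∀ w : ℝ, Integrable (fun x : ℝ => Real.exp (w * x)) (P i : Measure ℝ))
    (happrox : ∀ W : ℝ, ∃ K : ι → ℝ, Tendsto K l (𝓝 0) ∧ ∀ᶠ i in l, ∀ w : ℝ, |w| ≤ W →
      |(∫ x, Real.exp (w * x) ∂(P i : Measure ℝ)) -
          Real.exp (w ^ 2 * (∫ x, x ^ 2 ∂(P i : Measure ℝ)) / 2)| ≤ K i) :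
    ∃ v : ℝ, 0 ≤ v ∧ (P₀ : Measure ℝ) = gaussianReal 0 v.toNNReal ∧
      Tendsto (fun i => ∫ x, x ^ 2 ∂(P i : Measure ℝ)) l (𝓝 v) ∧
      ∀ w : ℝ, Integrable (fun x : ℝ => Real.exp (w * x)) (P₀ : Measure ℝ) ∧
        Tendsto (fun i => ∫ x, Real.exp (w * x) ∂(P i : Measure ℝ)) l
          (𝓝 (∫ x, Real.exp (w * x) ∂(P₀ : Measure ℝ))) := by
  -- notation
  set vr : ι → ℝ := fun i => ∫ x, x ^ 2 ∂(P i : Measure ℝ) with hvr_def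
  set mgf : ι → ℝ → ℝ := fun i w => ∫ x, Real.exp (w * x) ∂(P i : Measure ℝ) with hmgf_def
  have hvr0 : ∀ i, 0 ≤ vr i := fun i => integral_nonneg fun x => sq_nonneg x
  -- the approximation, with `K i ≤ 1` built in
  have happrox' : ∀ W : ℝ, ∃ K : ι → ℝ, Tendsto K l (𝓝 0) ∧ ∀ᶠ i in l, K i ≤ 1 ∧ ∀ w : ℝ,
      |w| ≤ W → |mgf i w - Real.exp (w ^ 2 * vr i / 2)| ≤ K i := by
    intro W
    obtain ⟨K, hK, hKb⟩ := happrox W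
    refine ⟨K, hK, ?_⟩
    filter_upwards [hKb, hK.eventually (gt_mem_nhds one_pos)] with i hi hi1
    exact ⟨hi1.le, hi⟩
  -- Step 1: the second moments are eventually bounded (tightness + Paley–Zygmund)
  obtain ⟨V, hV⟩ : ∃ V : ℝ, ∀ᶠ i in l, vr i ≤ V := by
    obtain ⟨K, -, hKb⟩ := happrox' 1
    refine eventually_variance_le_of_tendsto hP one_pos (B := 48 * (Real.exp (1 / 2) + 1)) ?_
    filter_upwards [hint, hKb] with i hi hKi
    intro (hv1 : 1 ≤ vr i)
    have hvpos : 0 < vr i := one_pos.trans_le hv1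
    set w : ℝ := (Real.sqrt (vr i))⁻¹ with hw_def
    have hsqrt_pos : 0 < Real.sqrt (vr i) := Real.sqrt_pos.mpr hvpos
    have hsqrt1 : 1 ≤ Real.sqrt (vr i) := by
      rw [← Real.sqrt_one]
      exact Real.sqrt_le_sqrt hv1
    have hwpos : 0 < w := inv_pos.mpr hsqrt_pos
    have hw1 : |w| ≤ 1 := by
      rw [abs_of_pos hwpos, hw_def]
      exact inv_le_one_of_one_le₀ hsqrt1
    have hw1' : |-w| ≤ 1 := by rwa [abs_neg]
    have hw2 : w ^ 2 * vr i = 1 := by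
      rw [hw_def, inv_pow, Real.sq_sqrt hvpos.le, inv_mul_cancel₀ hvpos.ne']
    have hw4 : 24 / w ^ 4 = 24 * vr i ^ 2 := by
      have : w ^ 4 = (w ^ 2) ^ 2 := by ring
      rw [this, div_eq_mul_inv, ← inv_pow]
      congr 1
      rw [(eq_inv_of_mul_eq_one_right hw2).symm]
    -- the two exponential moments at `± w` are at most `e^{1/2} + 1`
    have hbd : ∀ u : ℝ, |u| ≤ 1 → u ^ 2 = w ^ 2 → mgf i u ≤ Real.exp (1 / 2) + 1 := by
      intro u hu hu2
      have h := (hKi.2 u hu)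
      have h' : mgf i u - Real.exp (u ^ 2 * vr i / 2) ≤ 1 := (le_abs_self _).trans (h.trans hKi.1)
      rw [hu2, hw2] at h'
      linarith
    have h₁ := hbd w hw1 rfl
    have h₂ := hbd (-w) hw1' (by ring)
    obtain ⟨h4int, h4le⟩ := integral_pow_four_le_of_exp (P i : Measure ℝ) hwpos.ne' (hi w) (hi (-w))
    refine ⟨h4int, h4le.trans ?_⟩
    rw [hw4]
    have hm1 : mgf i w = ∫ x, Real.exp (w * x) ∂(P i : Measure ℝ) := rfl
    have hm2 : mgf i (-w) = ∫ x, Real.exp (-w * x) ∂(P i : Measure ℝ) := rfl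
    rw [← hm1, ← hm2]
    have : 0 ≤ vr i ^ 2 := sq_nonneg _
    nlinarith
  -- Step 2: uniform bounds on exponential moments, and their convergence
  have hbound : ∀ w : ℝ, ∀ᶠ i in l, mgf i w ≤ Real.exp (w ^ 2 * V / 2) + 1 := by
    intro w
    obtain ⟨K, -, hKb⟩ := happrox' |w|
    filter_upwards [hKb, hV] with i hKi hVi
    have h := hKi.2 w le_rfl
    have h' : mgf i w - Real.exp (w ^ 2 * vr i / 2) ≤ 1 := (le_abs_self _).trans (h.trans hKi.1)
    have h'' : Real.exp (w ^ 2 * vr i / 2) ≤ Real.exp (w ^ 2 * V / 2) := by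
      gcongr
    linarith
  have hconv : ∀ w : ℝ, Integrable (fun x : ℝ => Real.exp (w * x)) (P₀ : Measure ℝ) ∧
      Tendsto (fun i => mgf i w) l (𝓝 (∫ x, Real.exp (w * x) ∂(P₀ : Measure ℝ))) := by
    intro w
    have hsq : ∀ x : ℝ, Real.exp (w * x) ^ 2 = Real.exp (2 * w * x) := fun x => by
      rw [sq, ← Real.exp_add]; ring_nf
    have hB : ∀ᶠ i in l, Integrable (fun x => Real.exp (w * x) ^ 2) (P i : Measure ℝ) ∧
        ∫ x, Real.exp (w * x) ^ 2 ∂(P i : Measure ℝ) ≤ Real.exp ((2 * w) ^ 2 * V / 2) + 1 := by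
      filter_upwards [hint, hbound (2 * w)] with i hi hb
      simp_rw [hsq]
      exact ⟨hi (2 * w), hb⟩
    have key : ∀ u : ℕ → ι, Tendsto u atTop l →
        Integrable (fun x : ℝ => Real.exp (w * x)) (P₀ : Measure ℝ) ∧
          Tendsto (fun n => mgf (u n) w) atTop (𝓝 (∫ x, Real.exp (w * x) ∂(P₀ : Measure ℝ))) :=
      fun u hu => Literature.Probability.LatticeModels.tendsto_integral_of_tendsto_of_sq_le
        (hP.comp hu) (by fun_prop) (fun x => (Real.exp_pos _).le) (hu.eventually hB)
    obtain ⟨u₀, hu₀⟩ := l.exists_seq_tendsto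
    exact ⟨(key u₀ hu₀).1, tendsto_of_seq_tendsto fun u hu => (key u hu).2⟩
  -- Step 3: identification of the limit
  set M : ℝ → ℝ := fun w => ∫ x, Real.exp (w * x) ∂(P₀ : Measure ℝ) with hM_def
  have hgauss : ∀ w : ℝ, Tendsto (fun i => Real.exp (w ^ 2 * vr i / 2)) l (𝓝 (M w)) := by
    intro w
    obtain ⟨K, hK, hKb⟩ := happrox' |w|
    have h1 : Tendsto (fun i => mgf i w - Real.exp (w ^ 2 * vr i / 2)) l (𝓝 0) :=
      squeeze_zero_norm' (hKb.mono fun i hi => by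
        rw [Real.norm_eq_abs]; exact hi.2 w le_rfl) hK
    have h2 := (hconv w).2.sub h1
    rw [sub_zero] at h2
    exact h2.congr fun i => by ring
  have hgauss1 : Tendsto (fun i => Real.exp (vr i / 2)) l (𝓝 (M 1)) := by
    refine (hgauss 1).congr fun i => ?_
    rw [one_pow, one_mul]
  have hM1 : 1 ≤ M 1 :=
    ge_of_tendsto' hgauss1 fun i => Real.one_le_exp (by linarith [hvr0 i])
  have hM1pos : 0 < M 1 := one_pos.trans_le hM1
  set v : ℝ := 2 * Real.log (M 1) with hv_def
  have hvlim : Tendsto vr l (𝓝 v) := by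
    have h := (((Real.continuousAt_log hM1pos.ne').tendsto).comp hgauss1).const_mul 2
    refine h.congr fun i => ?_
    rw [Function.comp_apply, Real.log_exp]
    ring
  have hv0 : 0 ≤ v := mul_nonneg zero_le_two (Real.log_nonneg hM1)
  have hMw : ∀ w : ℝ, M w = Real.exp (v * w ^ 2 / 2) := by
    intro w
    have h : Tendsto (fun i => Real.exp (w ^ 2 * vr i / 2)) l (𝓝 (Real.exp (w ^ 2 * v / 2))) :=
      (Real.continuous_exp.tendsto _).comp ((hvlim.const_mul (w ^ 2)).div_const 2)
    rw [tendsto_nhds_unique (hgauss w) h]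
    ring_nf
  refine ⟨v, hv0, ?_, hvlim, hconv⟩
  exact Literature.Probability.LatticeModels.eq_gaussianReal_of_mgf_eq hv0
    (fun w => (hconv w).1) hMw

/-- **Lévy's continuity theorem along a countably generated filter** (Mathlib's
`ProbabilityMeasure.tendsto_of_tendsto_charFun` is stated for sequences; a filter with a
countable basis is tested along sequences, `Filter.tendsto_of_seq_tendsto`). [folklore] -/
theorem probabilityMeasure_tendsto_of_tendsto_charFun {F : Type*} [NormedAddCommGroup F]
    [InnerProductSpace ℝ F] [FiniteDimensional ℝ F] [MeasurableSpace F] [BorelSpace F]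
    {ι : Type*} {l : Filter ι} [l.IsCountablyGenerated]
    {P : ι → ProbabilityMeasure F} {P₀ : ProbabilityMeasure F}
    (h : ∀ t : F, Tendsto (fun i => charFun (P i : Measure F) t) l
      (𝓝 (charFun (P₀ : Measure F) t))) :
    Tendsto P l (𝓝 P₀) :=
  tendsto_of_seq_tendsto fun _ hu =>
    ProbabilityMeasure.tendsto_of_tendsto_charFun fun t => (h t).comp hu

end RealLine

/-! ### One-dimensional marginals of laws on `𝒮'` -/

section Marginals

variable {E : Type*} [NormedAddCommGroup E] [NormedSpace ℝ E]

/-- The one-dimensional marginals `law(ω(f))` of a family of laws on `𝒮'` can be packaged as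
`ProbabilityMeasure ℝ`-valued (with an irrelevant junk value at indices where the law is not a
probability measure), so that Mathlib's weak-convergence API applies. [folklore] -/
theorem exists_probabilityMeasure_eq_map_eval {ι : Type*} (ν : ι → Measure (FieldConfig E))
    (f : 𝓢(E, ℝ)) :
    ∃ P : ι → ProbabilityMeasure ℝ, ∀ i, IsProbabilityMeasure (ν i) →
      (P i : Measure ℝ) = (ν i).map (fun ω : FieldConfig E => ω f) := by
  classical
  refine ⟨fun i => if h : IsProbabilityMeasure (ν i) then
      ⟨(ν i).map (fun ω : FieldConfig E => ω f),
        haveI := h; Measure.isProbabilityMeasure_map (measurable_eval f).aemeasurable⟩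
    else ⟨Measure.dirac 0, Measure.dirac.isProbabilityMeasure⟩, fun i hi => ?_⟩
  simp only [dif_pos hi]
  rfl

/-- The characteristic function of the marginal of `ω(f)` is the generating functional along
the ray `t • f`. (Glimm–Jaffe 1987, §6.1.) [folklore] -/
theorem charFun_map_eval (ν : Measure (FieldConfig E)) (f : 𝓢(E, ℝ)) (t : ℝ) :
    charFun (ν.map (fun ω : FieldConfig E => ω f)) t = genFunctional ν (t • f) := by
  rw [genFunctional_smul_eq_charFun_map]
  rfl

/-- Integrals against the marginal of `ω(f)` are integrals over `𝒮'`. [folklore] -/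
theorem integral_map_eval (ν : Measure (FieldConfig E)) (f : 𝓢(E, ℝ)) {F : ℝ → ℝ}
    (hF : Continuous F) :
    ∫ x, F x ∂(ν.map (fun ω : FieldConfig E => ω f)) = ∫ ω, F (ω f) ∂ν :=
  integral_map (measurable_eval f).aemeasurable hF.aestronglyMeasurable

/-- Integrability against the marginal of `ω(f)` is integrability over `𝒮'`. [folklore] -/
theorem integrable_map_eval_iff (ν : Measure (FieldConfig E)) (f : 𝓢(E, ℝ)) {F : ℝ → ℝ}
    (hF : Continuous F) :
    Integrable F (ν.map (fun ω : FieldConfig E => ω f)) ↔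
      Integrable (fun ω : FieldConfig E => F (ω f)) ν :=
  integrable_map_measure hF.aestronglyMeasurable (measurable_eval f).aemeasurable

/-- **Convergence in law of random fields gives weak convergence of the one-dimensional
marginals** (Lévy's continuity theorem on each ray `t • f`, along a countably generated
filter), for any `ProbabilityMeasure ℝ`-packaging of the marginals. (Glimm–Jaffe 1987, §6.1;
Billingsley, *Convergence of Probability Measures*, §1.) [folklore] -/
theorem tendsto_marginal_of_tendstoInLaw {ι : Type*} {l : Filter ι} [l.IsCountablyGenerated]
    {ν : ι → Measure (FieldConfig E)} {μ : Measure (FieldConfig E)} (hlim : TendstoInLaw ν l μ)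
    (f : 𝓢(E, ℝ)) {P : ι → ProbabilityMeasure ℝ} {P₀ : ProbabilityMeasure ℝ}
    (hP : ∀ᶠ i in l, (P i : Measure ℝ) = (ν i).map (fun ω : FieldConfig E => ω f))
    (hP₀ : (P₀ : Measure ℝ) = μ.map (fun ω : FieldConfig E => ω f)) :
    Tendsto P l (𝓝 P₀) := by
  refine probabilityMeasure_tendsto_of_tendsto_charFun fun t => ?_
  rw [hP₀, charFun_map_eval]
  refine (hlim (t • f)).congr' ?_
  filter_upwards [hP] with i hi
  rw [hi, charFun_map_eval]

/-- **Exponential moments pass to limits in law under a uniform bound.** If `ν_i → μ` in law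
on `𝒮'` (countably generated filter, `ν_i` probability laws eventually) and, eventually,
`∫ e^{2w ω(f)} dν_i ≤ B`, then `e^{w ω(f)}` is `μ`-integrable and
`∫ e^{w ω(f)} dν_i → ∫ e^{w ω(f)} dμ` (truncation; `tendsto_integral_of_tendsto_of_sq_le`). This
is how bounds printed for infinite-volume states transfer to thermodynamic limits in law of
finite-volume laws. [folklore] -/
theorem tendsto_integral_exp_eval_of_tendstoInLaw {ι : Type*} {l : Filter ι} [l.NeBot]
    [l.IsCountablyGenerated] {ν : ι → Measure (FieldConfig E)} {μ : Measure (FieldConfig E)}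
    (hprob : ∀ᶠ i in l, IsProbabilityMeasure (ν i)) (hlim : TendstoInLaw ν l μ) (f : 𝓢(E, ℝ))
    (w : ℝ) {B : ℝ}
    (hB : ∀ᶠ i in l, Integrable (fun ω : FieldConfig E => Real.exp (2 * w * ω f)) (ν i) ∧
      ∫ ω, Real.exp (2 * w * ω f) ∂ν i ≤ B) :
    Integrable (fun ω : FieldConfig E => Real.exp (w * ω f)) μ ∧
      Tendsto (fun i => ∫ ω, Real.exp (w * ω f) ∂ν i) l (𝓝 (∫ ω, Real.exp (w * ω f) ∂μ)) := by
  haveI : IsProbabilityMeasure μ := isProbabilityMeasure_of_tendstoInLaw hprob hlim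
  obtain ⟨P, hP⟩ := exists_probabilityMeasure_eq_map_eval ν f
  let P₀ : ProbabilityMeasure ℝ := ⟨μ.map (fun ω : FieldConfig E => ω f),
    Measure.isProbabilityMeasure_map (measurable_eval f).aemeasurable⟩
  have hP₀ : (P₀ : Measure ℝ) = μ.map (fun ω : FieldConfig E => ω f) := rfl
  have hPev : ∀ᶠ i in l, (P i : Measure ℝ) = (ν i).map (fun ω : FieldConfig E => ω f) :=
    hprob.mono fun i hi => hP i hi
  have hconv := tendsto_marginal_of_tendstoInLaw hlim f hPev hP₀
  have hsq : ∀ x : ℝ, Real.exp (w * x) ^ 2 = Real.exp (2 * w * x) := fun x => by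
    rw [sq, ← Real.exp_add]; ring_nf
  have hB' : ∀ᶠ i in l, Integrable (fun x => Real.exp (w * x) ^ 2) (P i : Measure ℝ) ∧
      ∫ x, Real.exp (w * x) ^ 2 ∂(P i : Measure ℝ) ≤ B := by
    filter_upwards [hB, hPev] with i hi hPi
    simp_rw [hsq]
    rw [hPi, integrable_map_eval_iff (ν i) f (by fun_prop), integral_map_eval (ν i) f (by fun_prop)]
    exact hi
  have key : ∀ u : ℕ → ι, Tendsto u atTop l →
      Integrable (fun x : ℝ => Real.exp (w * x)) (P₀ : Measure ℝ) ∧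
        Tendsto (fun n => ∫ x, Real.exp (w * x) ∂(P (u n) : Measure ℝ)) atTop
          (𝓝 (∫ x, Real.exp (w * x) ∂(P₀ : Measure ℝ))) :=
    fun u hu => Literature.Probability.LatticeModels.tendsto_integral_of_tendsto_of_sq_le
      (hconv.comp hu) (by fun_prop) (fun x => (Real.exp_pos _).le) (hu.eventually hB')
  obtain ⟨u₀, hu₀⟩ := l.exists_seq_tendsto
  have hint₀ := (key u₀ hu₀).1
  rw [hP₀, integrable_map_eval_iff μ f (by fun_prop)] at hint₀
  refine ⟨hint₀, ?_⟩
  have h2 : Tendsto (fun i => ∫ x, Real.exp (w * x) ∂(P i : Measure ℝ)) l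
      (𝓝 (∫ x, Real.exp (w * x) ∂(P₀ : Measure ℝ))) :=
    tendsto_of_seq_tendsto fun u hu => (key u hu).2
  rw [hP₀, integral_map_eval μ f (by fun_prop)] at h2
  refine h2.congr' ?_
  filter_upwards [hPev] with i hPi
  rw [hPi, integral_map_eval (ν i) f (by fun_prop)]

/-- **Second moments pass to limits in law under a uniform fourth-moment bound**: if
`ν_i → μ` in law on `𝒮'` (countably generated filter, probability laws eventually) and,
eventually, `∫ ω(f)⁴ dν_i ≤ B`, then `ω(f) ∈ L²(μ)` and `∫ ω(f)² dν_i → ∫ ω(f)² dμ`.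
[folklore] -/
theorem tendsto_integral_sq_eval_of_tendstoInLaw {ι : Type*} {l : Filter ι} [l.NeBot]
    [l.IsCountablyGenerated] {ν : ι → Measure (FieldConfig E)} {μ : Measure (FieldConfig E)}
    (hprob : ∀ᶠ i in l, IsProbabilityMeasure (ν i)) (hlim : TendstoInLaw ν l μ) (f : 𝓢(E, ℝ))
    {B : ℝ}
    (hB : ∀ᶠ i in l, Integrable (fun ω : FieldConfig E => (ω f) ^ 4) (ν i) ∧
      ∫ ω, (ω f) ^ 4 ∂ν i ≤ B) :
    Integrable (fun ω : FieldConfig E => (ω f) ^ 2) μ ∧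
      Tendsto (fun i => ∫ ω, (ω f) ^ 2 ∂ν i) l (𝓝 (∫ ω, (ω f) ^ 2 ∂μ)) := by
  haveI : IsProbabilityMeasure μ := isProbabilityMeasure_of_tendstoInLaw hprob hlim
  obtain ⟨P, hP⟩ := exists_probabilityMeasure_eq_map_eval ν f
  let P₀ : ProbabilityMeasure ℝ := ⟨μ.map (fun ω : FieldConfig E => ω f),
    Measure.isProbabilityMeasure_map (measurable_eval f).aemeasurable⟩
  have hP₀ : (P₀ : Measure ℝ) = μ.map (fun ω : FieldConfig E => ω f) := rfl
  have hPev : ∀ᶠ i in l, (P i : Measure ℝ) = (ν i).map (fun ω : FieldConfig E => ω f) :=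
    hprob.mono fun i hi => hP i hi
  have hconv := tendsto_marginal_of_tendstoInLaw hlim f hPev hP₀
  have hsq : ∀ x : ℝ, (x ^ 2) ^ 2 = x ^ 4 := fun x => by ring
  have hB' : ∀ᶠ i in l, Integrable (fun x : ℝ => (x ^ 2) ^ 2) (P i : Measure ℝ) ∧
      ∫ x, (x ^ 2) ^ 2 ∂(P i : Measure ℝ) ≤ B := by
    filter_upwards [hB, hPev] with i hi hPi
    simp_rw [hsq]
    rw [hPi, integrable_map_eval_iff (ν i) f (by fun_prop), integral_map_eval (ν i) f (by fun_prop)]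
    exact hi
  have key : ∀ u : ℕ → ι, Tendsto u atTop l →
      Integrable (fun x : ℝ => x ^ 2) (P₀ : Measure ℝ) ∧
        Tendsto (fun n => ∫ x, x ^ 2 ∂(P (u n) : Measure ℝ)) atTop
          (𝓝 (∫ x, x ^ 2 ∂(P₀ : Measure ℝ))) :=
    fun u hu => Literature.Probability.LatticeModels.tendsto_integral_of_tendsto_of_sq_le
      (hconv.comp hu) (by fun_prop) (fun x => sq_nonneg x) (hu.eventually hB')
  obtain ⟨u₀, hu₀⟩ := l.exists_seq_tendsto
  have hint₀ := (key u₀ hu₀).1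
  rw [hP₀, integrable_map_eval_iff μ f (by fun_prop)] at hint₀
  refine ⟨hint₀, ?_⟩
  have h2 : Tendsto (fun i => ∫ x, x ^ 2 ∂(P i : Measure ℝ)) l
      (𝓝 (∫ x, x ^ 2 ∂(P₀ : Measure ℝ))) :=
    tendsto_of_seq_tendsto fun u hu => (key u hu).2
  rw [hP₀, integral_map_eval μ f (by fun_prop)] at h2
  refine h2.congr' ?_
  filter_upwards [hPev] with i hPi
  rw [hPi, integral_map_eval (ν i) f (by fun_prop)]

/-- **Asymptotically Gaussian marginals have Gaussian limits** (the one-test-function form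
of the assembly; Aizenman–Duminil-Copin 2021, p. 6). Let `ν_i → μ` in law on `𝒮'` along a
non-trivial countably generated filter, `ν_i` probability laws eventually, and let `f` be a
test function such that, eventually, all exponential moments of `ω(f)` under `ν_i` are finite
and the moment generating function `w ↦ ∫ e^{w ω(f)} dν_i` is within `K_i → 0` of
`exp(w² v_i/2)`, `v_i = ∫ ω(f)² dν_i`, locally uniformly in `w`. Then the law of `ω(f)` under
`μ` is the centred Gaussian `N(0, v)` with `v = lim v_i`. [cite: AizenmanDuminilCopinAnnals2021, p. 6 (display after Prop. 1.4)] -/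
theorem map_eval_eq_gaussianReal_of_tendstoInLaw {ι : Type*} {l : Filter ι} [l.NeBot]
    [l.IsCountablyGenerated] {ν : ι → Measure (FieldConfig E)} {μ : Measure (FieldConfig E)}
    (hprob : ∀ᶠ i in l, IsProbabilityMeasure (ν i)) (hlim : TendstoInLaw ν l μ) (f : 𝓢(E, ℝ))
    (hint : ∀ᶠ i in l, ∀ w : ℝ, Integrable (fun ω : FieldConfig E => Real.exp (w * ω f)) (ν i))
    (happrox : ∀ W : ℝ, ∃ K : ι → ℝ, Tendsto K l (𝓝 0) ∧ ∀ᶠ i in l, ∀ w : ℝ, |w| ≤ W →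
      |(∫ ω, Real.exp (w * ω f) ∂ν i) - Real.exp (w ^ 2 * (∫ ω, (ω f) ^ 2 ∂ν i) / 2)| ≤ K i) :
    ∃ v : ℝ, 0 ≤ v ∧
      μ.map (fun ω : FieldConfig E => ω f) = gaussianReal 0 v.toNNReal ∧
      Tendsto (fun i => ∫ ω, (ω f) ^ 2 ∂ν i) l (𝓝 v) := by
  haveI : IsProbabilityMeasure μ := isProbabilityMeasure_of_tendstoInLaw hprob hlim
  obtain ⟨P, hP⟩ := exists_probabilityMeasure_eq_map_eval ν f
  let P₀ : ProbabilityMeasure ℝ := ⟨μ.map (fun ω : FieldConfig E => ω f),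
    Measure.isProbabilityMeasure_map (measurable_eval f).aemeasurable⟩
  have hP₀ : (P₀ : Measure ℝ) = μ.map (fun ω : FieldConfig E => ω f) := rfl
  have hPev : ∀ᶠ i in l, (P i : Measure ℝ) = (ν i).map (fun ω : FieldConfig E => ω f) :=
    hprob.mono fun i hi => hP i hi
  have hconv := tendsto_marginal_of_tendstoInLaw hlim f hPev hP₀
  -- transfer the hypotheses to the marginals
  have hint' : ∀ᶠ i in l, ∀ w : ℝ,
      Integrable (fun x : ℝ => Real.exp (w * x)) (P i : Measure ℝ) := by
    filter_upwards [hPev, hint] with i hi hw w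
    rw [hi, integrable_map_eval_iff (ν i) f (by fun_prop)]
    exact hw w
  have happrox' : ∀ W : ℝ, ∃ K : ι → ℝ, Tendsto K l (𝓝 0) ∧ ∀ᶠ i in l, ∀ w : ℝ, |w| ≤ W →
      |(∫ x, Real.exp (w * x) ∂(P i : Measure ℝ)) -
          Real.exp (w ^ 2 * (∫ x, x ^ 2 ∂(P i : Measure ℝ)) / 2)| ≤ K i := by
    intro W
    obtain ⟨K, hK, hKb⟩ := happrox W
    refine ⟨K, hK, ?_⟩
    filter_upwards [hPev, hKb] with i hi hb w hw
    rw [hi, integral_map_eval (ν i) f (by fun_prop), integral_map_eval (ν i) f (by fun_prop)]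
    exact hb w hw
  obtain ⟨v, hv0, hv, hvlim, -⟩ :=
    eq_gaussianReal_of_tendsto_of_mgf_approx hconv hint' happrox'
  refine ⟨v, hv0, ?_, ?_⟩
  · rw [← hP₀, hv]
  · refine hvlim.congr' ?_
    filter_upwards [hPev] with i hi
    rw [hi, integral_map_eval (ν i) f (by fun_prop)]

end Marginals

/-! ### From compactly supported test functions to all test functions, and to `IsGaussian` -/

section Gaussian

variable {E : Type*} [NormedAddCommGroup E] [NormedSpace ℝ E]

/-- The generating functional of a finite law on `𝒮'` is sequentially continuous on `𝒮`
(dominated convergence; each `ω ∈ 𝒮'` is continuous on `𝒮`). (Glimm–Jaffe 1987, §6.1;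
Gel'fand–Vilenkin IV §3.) [folklore] -/
theorem tendsto_genFunctional_of_tendsto (μ : Measure (FieldConfig E)) [IsFiniteMeasure μ]
    {g : ℕ → 𝓢(E, ℝ)} {f : 𝓢(E, ℝ)} (hg : Tendsto g atTop (𝓝 f)) :
    Tendsto (fun n => genFunctional μ (g n)) atTop (𝓝 (genFunctional μ f)) := by
  unfold genFunctional
  refine tendsto_integral_of_dominated_convergence (fun _ => (1 : ℝ))
    (fun n => (Complex.continuous_exp.measurable.comp
      ((Complex.measurable_ofReal.comp (measurable_eval (g n))).const_mul I)).aestronglyMeasurable)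
    (integrable_const _) (fun n => Eventually.of_forall fun ω => ?_)
    (Eventually.of_forall fun ω => ?_)
  · rw [mul_comm, Complex.norm_exp_ofReal_mul_I]
  · have hω : Tendsto (fun n => (ω : FieldConfig E) (g n)) atTop (𝓝 (ω f)) :=
      ((map_continuous ω).tendsto f).comp hg
    have h2 : Tendsto (fun n => I * ((ω (g n) : ℝ) : ℂ)) atTop (𝓝 (I * ((ω f : ℝ) : ℂ))) :=
      ((Complex.continuous_ofReal.tendsto _).comp hω).const_mul I
    exact (Complex.continuous_exp.tendsto _).comp h2

/-- **Limits of centred Gaussian marginals are centred Gaussian.** If `μ` is a probability law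
on `𝒮'(E)` (`E` finite dimensional) all of whose marginals `ω(g)`, `g` compactly supported, are
centred Gaussians, then so are all its marginals `ω(f)`, `f ∈ 𝒮`: compactly supported Schwartz
functions are sequentially dense (`exists_hasCompactSupport_tendsto`), `S_μ(t gₙ) = e^{-vₙt²/2}`
converges to the characteristic function of `ω(f)`, which is continuous and `1` at `0`, forcing
`vₙ → v` and `law(ω(f)) = N(0, v)` (Lévy; uniqueness `Measure.ext_of_charFun`).
(Glimm–Jaffe 1987, §6.2.) [folklore] -/
theorem map_eval_eq_gaussianReal_of_hasCompactSupport [FiniteDimensional ℝ E]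
    {μ : Measure (FieldConfig E)} [IsProbabilityMeasure μ]
    (h : ∀ g : 𝓢(E, ℝ), HasCompactSupport g → ∃ v : ℝ≥0,
      μ.map (fun ω : FieldConfig E => ω g) = gaussianReal 0 v)
    (f : 𝓢(E, ℝ)) : ∃ v : ℝ≥0, μ.map (fun ω : FieldConfig E => ω f) = gaussianReal 0 v := by
  obtain ⟨u, hu, hlim⟩ := exists_hasCompactSupport_tendsto f
  choose v hv using fun n => h (u n) (hu n)
  haveI : IsProbabilityMeasure (μ.map fun ω : FieldConfig E => ω f) :=
    Measure.isProbabilityMeasure_map (measurable_eval f).aemeasurable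
  set φ : ℝ → ℂ := charFun (μ.map (fun ω : FieldConfig E => ω f)) with hφ_def
  -- the characteristic functions of the approximating marginals converge to `φ`
  have hconv : ∀ t : ℝ,
      Tendsto (fun n => cexp (((-((v n : ℝ) * t ^ 2 / 2) : ℝ) : ℂ))) atTop (𝓝 (φ t)) := by
    intro t
    have h1 : Tendsto (fun n => genFunctional μ (t • u n)) atTop (𝓝 (genFunctional μ (t • f))) :=
      tendsto_genFunctional_of_tendsto μ (hlim.const_smul t)
    rw [hφ_def, charFun_map_eval]
    refine h1.congr fun n => ?_
    rw [← charFun_map_eval, hv n, charFun_gaussianReal]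
    congr 1
    push_cast
    ring
  -- `φ` is continuous with `φ 0 = 1`, hence `‖φ t₀‖ > 1/2` for some `t₀ ≠ 0`
  have hφcont : Continuous φ := continuous_charFun
  have hφ0 : φ 0 = 1 := by
    rw [hφ_def, charFun_zero, probReal_univ, Complex.ofReal_one]
  obtain ⟨t₀, ht₀, hφt₀⟩ : ∃ t₀ : ℝ, t₀ ≠ 0 ∧ 1 / 2 < ‖φ t₀‖ := by
    have hc : ContinuousAt φ 0 := hφcont.continuousAt
    rw [Metric.continuousAt_iff] at hc
    obtain ⟨δ, hδ, hδb⟩ := hc (1 / 2) one_half_pos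
    refine ⟨δ / 2, by positivity, ?_⟩
    have hd : dist (φ (δ / 2)) (φ 0) < 1 / 2 := hδb (by
      rw [Real.dist_eq, sub_zero, abs_of_pos (by positivity)]
      linarith)
    rw [hφ0, dist_eq_norm] at hd
    have h1 : ‖(1 : ℂ)‖ - ‖φ (δ / 2)‖ ≤ ‖(1 : ℂ) - φ (δ / 2)‖ := norm_sub_norm_le _ _
    rw [norm_one, norm_sub_rev] at h1
    linarith
  -- hence the variances converge
  have hnorm : Tendsto (fun n => Real.exp (-((v n : ℝ) * t₀ ^ 2 / 2))) atTop (𝓝 ‖φ t₀‖) := by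
    refine ((hconv t₀).norm).congr fun n => ?_
    exact Complex.norm_exp_ofReal _
  have hφt₀pos : 0 < ‖φ t₀‖ := one_half_pos.trans hφt₀
  set vlim : ℝ := -2 * Real.log ‖φ t₀‖ / t₀ ^ 2 with hvlim_def
  have ht₀2 : 0 < t₀ ^ 2 := by positivity
  have hvconv : Tendsto (fun n => (v n : ℝ)) atTop (𝓝 vlim) := by
    have hlog := ((Real.continuousAt_log hφt₀pos.ne').tendsto).comp hnorm
    have h2 : Tendsto (fun n => -2 * Real.log (Real.exp (-((v n : ℝ) * t₀ ^ 2 / 2))) / t₀ ^ 2)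
        atTop (𝓝 vlim) := (hlog.const_mul (-2)).div_const _
    refine h2.congr fun n => ?_
    rw [Real.log_exp]
    field_simp
  have hvlim0 : 0 ≤ vlim := ge_of_tendsto' hvconv fun n => (v n).coe_nonneg
  -- so `φ` is the characteristic function of `N(0, vlim)`
  refine ⟨vlim.toNNReal, Measure.ext_of_charFun (funext fun t => ?_)⟩
  have h1 : Tendsto (fun n => cexp (((-((v n : ℝ) * t ^ 2 / 2) : ℝ) : ℂ))) atTop
      (𝓝 (cexp (((-(vlim * t ^ 2 / 2) : ℝ) : ℂ)))) :=
    (Complex.continuous_exp.tendsto _).comp ((Complex.continuous_ofReal.tendsto _).comp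
      (((hvconv.mul_const (t ^ 2)).div_const 2).neg))
  rw [← hφ_def, tendsto_nhds_unique (hconv t) h1, charFun_gaussianReal,
    Real.coe_toNNReal _ hvlim0]
  congr 1
  push_cast
  ring

/-- **Weak representation theorem for `𝒮'`**: every continuous linear functional on
`FieldConfig E = 𝒮(E) →Lₚₜ ℝ` (weak-* topology) is an evaluation `ω ↦ ω(f)` at a test function
(Mathlib `LinearMap.dualEmbedding_surjective` for `WeakDual`, transported along
`PointwiseConvergenceCLM.equivWeakDual`). (Gel'fand–Vilenkin IV §1.) This is the tree's
`exists_strongDual_eq_eval` (`OSAxiomsFreeFieldExistenceProofs.lean`), of which this name is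
kept only as a deprecated restatement (dedup-00597). [folklore] -/
@[deprecated exists_strongDual_eq_eval (since := "2026-08-15")]
theorem exists_eval_eq_of_strongDual (L : StrongDual ℝ (FieldConfig E)) :
    ∃ f : 𝓢(E, ℝ), ∀ ω : FieldConfig E, L ω = ω f :=
  exists_strongDual_eq_eval L

/-- **Gaussian marginals make a Gaussian law on `𝒮'`.** If every one-dimensional marginal
`ω(f)` of a law `μ` on `𝒮'` is Gaussian, then `μ` is Gaussian in Mathlib's sense
(`ProbabilityTheory.IsGaussian`: every continuous linear functional has a Gaussian law), since
the continuous linear functionals of `𝒮'` are exactly the evaluations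
(`exists_strongDual_eq_eval`). (Glimm–Jaffe 1987, §6.2; Gel'fand–Vilenkin IV §3.)
[folklore] -/
theorem isGaussian_of_map_eval_eq_gaussianReal {μ : Measure (FieldConfig E)}
    (h : ∀ f : 𝓢(E, ℝ), ∃ (m : ℝ) (v : ℝ≥0),
      μ.map (fun ω : FieldConfig E => ω f) = gaussianReal m v) :
    IsGaussian μ := by
  refine isGaussian_of_map_eq_gaussianReal fun L => ?_
  obtain ⟨f, hf⟩ := exists_strongDual_eq_eval L
  obtain ⟨m, v, hv⟩ := h f
  refine ⟨m, v, ?_⟩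
  have : (L : FieldConfig E → ℝ) = fun ω => ω f := funext hf
  rw [this, hv]

end Gaussian

/-! ### Gaussianity of limits in law: the assembly theorems -/

section Assembly

variable {E : Type*} [NormedAddCommGroup E] [NormedSpace ℝ E] [FiniteDimensional ℝ E]
variable {ι : Type*} {l : Filter ι} [l.NeBot] [l.IsCountablyGenerated]
  {ν : ι → Measure (FieldConfig E)} {μ : Measure (FieldConfig E)}

/-- **Limits in law of laws with asymptotically Gaussian marginals are Gaussian** (the
probabilistic assembly behind Aizenman–Duminil-Copin 2021, Thm 1.2, from Prop. 1.4 / 7.2 and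
the remark on p. 6; law-level, model-independent form). Let `ν_i → μ` in law on `𝒮'(E)` (`E`
finite dimensional) along a non-trivial countably generated filter, `ν_i` probability laws
eventually. Suppose that for every *compactly supported* test function `f`, eventually all
exponential moments of `ω(f)` under `ν_i` are finite and the moment generating function
`w ↦ ∫ e^{w ω(f)} dν_i` is within `K_i → 0` of `exp(w² v_i/2)`, `v_i = ∫ ω(f)² dν_i` its own
second moment, locally uniformly in `w`. Then `μ` is a Gaussian law
(`ProbabilityTheory.IsGaussian`; all marginals are centred, `map_eval_eq_gaussianReal_of_tendstoInLaw`,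
`map_eval_eq_gaussianReal_of_hasCompactSupport`, `isGaussian_of_map_eval_eq_gaussianReal`).
[cite: AizenmanDuminilCopinAnnals2021, Thm 1.2 with Prop. 1.4 and p. 6] -/
theorem isGaussian_of_tendstoInLaw_of_mgfApprox
    (hprob : ∀ᶠ i in l, IsProbabilityMeasure (ν i)) (hlim : TendstoInLaw ν l μ)
    (h : ∀ f : 𝓢(E, ℝ), HasCompactSupport f →
      (∀ᶠ i in l, ∀ w : ℝ, Integrable (fun ω : FieldConfig E => Real.exp (w * ω f)) (ν i)) ∧
      ∀ W : ℝ, ∃ K : ι → ℝ, Tendsto K l (𝓝 0) ∧ ∀ᶠ i in l, ∀ w : ℝ, |w| ≤ W →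
        |(∫ ω, Real.exp (w * ω f) ∂ν i) - Real.exp (w ^ 2 * (∫ ω, (ω f) ^ 2 ∂ν i) / 2)|
          ≤ K i) :
    IsGaussian μ := by
  haveI : IsProbabilityMeasure μ := isProbabilityMeasure_of_tendstoInLaw hprob hlim
  refine isGaussian_of_map_eval_eq_gaussianReal fun f => ⟨0, ?_⟩
  refine map_eval_eq_gaussianReal_of_hasCompactSupport (fun g hg => ?_) f
  obtain ⟨v, -, hv, -⟩ :=
    map_eval_eq_gaussianReal_of_tendstoInLaw hprob hlim g (h g hg).1 (h g hg).2
  exact ⟨v.toNNReal, hv⟩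

omit [FiniteDimensional ℝ E] [l.NeBot] [l.IsCountablyGenerated] in
/-- From a bound of the form `K_i G(s_i w²)` with a bounded non-negative scale `s_i`, `K_i → 0`
and `G` monotone on `[0, ∞)`, to a bound `K'_i → 0` uniform over `|w| ≤ W`. [folklore] -/
theorem exists_uniform_bound_of_scaleBound {e : ι → ℝ → ℝ} {s K : ι → ℝ} {G : ℝ → ℝ} {S : ℝ}
    (hs : ∀ᶠ i in l, 0 ≤ s i) (hS : ∀ᶠ i in l, s i ≤ S) (hK : Tendsto K l (𝓝 0))
    (hG : MonotoneOn G (Set.Ici 0)) (hbd : ∀ᶠ i in l, ∀ w : ℝ, e i w ≤ K i * G (s i * w ^ 2))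
    (W : ℝ) :
    ∃ K' : ι → ℝ, Tendsto K' l (𝓝 0) ∧ ∀ᶠ i in l, ∀ w : ℝ, |w| ≤ W → e i w ≤ K' i := by
  set S' : ℝ := max S 0 with hS'_def
  set Γ : ℝ := max |G 0| |G (S' * W ^ 2)| with hΓ_def
  refine ⟨fun i => |K i| * Γ, ?_, ?_⟩
  · have h := (continuous_abs.tendsto (0 : ℝ)).comp hK
    rw [abs_zero] at h
    simpa using h.mul_const Γ
  · filter_upwards [hs, hS, hbd] with i hsi hSi hbi w hw
    have hx0 : 0 ≤ s i * w ^ 2 := mul_nonneg hsi (sq_nonneg w)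
    have hx1 : s i * w ^ 2 ≤ S' * W ^ 2 := by
      have hw2 : w ^ 2 ≤ W ^ 2 := by
        rw [← sq_abs w, ← sq_abs W]
        exact pow_le_pow_left₀ (abs_nonneg w) (hw.trans (le_abs_self W)) 2
      exact mul_le_mul (hSi.trans (le_max_left _ _)) hw2 (sq_nonneg w) (le_max_right _ _)
    have hG0 : G 0 ≤ G (s i * w ^ 2) := hG (Set.mem_Ici.mpr le_rfl) (Set.mem_Ici.mpr hx0) hx0
    have hG1 : G (s i * w ^ 2) ≤ G (S' * W ^ 2) :=
      hG (Set.mem_Ici.mpr hx0) (Set.mem_Ici.mpr (hx0.trans hx1)) hx1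
    have hGabs : |G (s i * w ^ 2)| ≤ Γ := by
      rw [abs_le]
      constructor
      · have : -Γ ≤ -|G 0| := neg_le_neg (le_max_left _ _)
        exact this.trans ((neg_abs_le _).trans hG0)
      · exact (hG1.trans (le_abs_self _)).trans (le_max_right _ _)
    calc e i w ≤ K i * G (s i * w ^ 2) := hbi w
      _ ≤ |K i * G (s i * w ^ 2)| := le_abs_self _
      _ = |K i| * |G (s i * w ^ 2)| := abs_mul _ _
      _ ≤ |K i| * Γ := mul_le_mul_of_nonneg_left hGabs (abs_nonneg _)

omit [FiniteDimensional ℝ E] in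
/-- **The scale is bounded** (Slutsky-type renormalisation step; Aizenman–Duminil-Copin 2021,
p. 6, "`⟨T_{f,L}²⟩_β ≥ c_f > 0` uniformly"). In the setting of
`isGaussian_of_tendstoInLaw_of_scaleBound`: if the exponential moments of `ω(f₀)` under `ν_i`
are within `K_i G(s_i w²)` of `exp(w² v_i/2)` (`v_i = ∫ ω(f₀)² dν_i`) for a non-negative scale
`s_i` with `c s_i ≤ v_i`, then `s_i` is eventually bounded: at `w = ±v_i^{-1/2}` the error is at
most `K_i G(1/c) → 0`, which bounds the fourth moment of `ω(f₀)` by a multiple of `v_i²`, so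
tightness of the convergent marginals bounds `v_i` (`eventually_variance_le_of_tendsto`), hence
`s_i ≤ v_i / c`. [cite: AizenmanDuminilCopinAnnals2021, p. 6 (display after Prop. 1.4)] -/
theorem eventually_scale_le_of_tendstoInLaw
    (hprob : ∀ᶠ i in l, IsProbabilityMeasure (ν i)) (hlim : TendstoInLaw ν l μ)
    {s : ι → ℝ} (hs : ∀ᶠ i in l, 0 ≤ s i) {f₀ : 𝓢(E, ℝ)} {c : ℝ} (hc : 0 < c)
    (hlow : ∀ᶠ i in l, c * s i ≤ ∫ ω, (ω f₀) ^ 2 ∂ν i)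
    {K : ι → ℝ} {G : ℝ → ℝ} (hK : Tendsto K l (𝓝 0)) (hG : MonotoneOn G (Set.Ici 0))
    (hint : ∀ᶠ i in l, ∀ w : ℝ, Integrable (fun ω : FieldConfig E => Real.exp (w * ω f₀)) (ν i))
    (hbd : ∀ᶠ i in l, ∀ w : ℝ,
      |(∫ ω, Real.exp (w * ω f₀) ∂ν i) - Real.exp (w ^ 2 * (∫ ω, (ω f₀) ^ 2 ∂ν i) / 2)|
        ≤ K i * G (s i * w ^ 2)) :
    ∃ S : ℝ, ∀ᶠ i in l, s i ≤ S := by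
  haveI : IsProbabilityMeasure μ := isProbabilityMeasure_of_tendstoInLaw hprob hlim
  obtain ⟨P, hP⟩ := exists_probabilityMeasure_eq_map_eval ν f₀
  let P₀ : ProbabilityMeasure ℝ := ⟨μ.map (fun ω : FieldConfig E => ω f₀),
    Measure.isProbabilityMeasure_map (measurable_eval f₀).aemeasurable⟩
  have hP₀ : (P₀ : Measure ℝ) = μ.map (fun ω : FieldConfig E => ω f₀) := rfl
  have hPev : ∀ᶠ i in l, (P i : Measure ℝ) = (ν i).map (fun ω : FieldConfig E => ω f₀) :=
    hprob.mono fun i hi => hP i hi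
  have hconv := tendsto_marginal_of_tendstoInLaw hlim f₀ hPev hP₀
  -- `|G| ≤ Γ` on `[0, 1/c]`, and eventually `|K i| Γ ≤ 1`
  set Γ : ℝ := max |G 0| |G (1 / c)| with hΓ_def
  have hKev : ∀ᶠ i in l, |K i| * Γ ≤ 1 := by
    have h := (continuous_abs.tendsto (0 : ℝ)).comp hK
    rw [abs_zero] at h
    have h2 : Tendsto (fun i => |K i| * Γ) l (𝓝 0) := by simpa using h.mul_const Γ
    exact (h2.eventually (gt_mem_nhds one_pos)).mono fun i hi => hi.le
  -- variance bound via tightness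
  obtain ⟨V, hV⟩ : ∃ V : ℝ, ∀ᶠ i in l, ∫ ω, (ω f₀) ^ 2 ∂ν i ≤ V := by
    obtain ⟨V, hV⟩ := eventually_variance_le_of_tendsto hconv one_pos
      (B := 48 * (Real.exp (1 / 2) + 1)) (by
        filter_upwards [hPev, hs, hlow, hint, hbd, hKev] with i hPi hsi hlowi hinti hbdi hKi
        rw [hPi, integral_map_eval (ν i) f₀ (by fun_prop), integral_map_eval (ν i) f₀ (by fun_prop),
          integrable_map_eval_iff (ν i) f₀ (by fun_prop)]
        intro hv1
        set v : ℝ := ∫ ω, (ω f₀) ^ 2 ∂ν i with hv_def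
        have hvpos : 0 < v := one_pos.trans_le hv1
        set w : ℝ := (Real.sqrt v)⁻¹ with hw_def
        have hsqrt_pos : 0 < Real.sqrt v := Real.sqrt_pos.mpr hvpos
        have hwpos : 0 < w := inv_pos.mpr hsqrt_pos
        have hw2 : w ^ 2 * v = 1 := by
          rw [hw_def, inv_pow, Real.sq_sqrt hvpos.le, inv_mul_cancel₀ hvpos.ne']
        have hw2' : w ^ 2 = v⁻¹ := eq_inv_of_mul_eq_one_left hw2
        -- the error at `± w` is at most `1`
        have herr : ∀ u : ℝ, u ^ 2 = w ^ 2 →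
            ∫ ω, Real.exp (u * ω f₀) ∂ν i ≤ Real.exp (1 / 2) + 1 := by
          intro u hu
          have hb := hbdi u
          have hx0 : 0 ≤ s i * u ^ 2 := mul_nonneg hsi (sq_nonneg u)
          have hx1 : s i * u ^ 2 ≤ 1 / c := by
            rw [hu, hw2', ← div_eq_mul_inv, div_le_div_iff₀ hvpos hc, one_mul, mul_comm]
            exact hlowi
          have hG0 : G 0 ≤ G (s i * u ^ 2) :=
            hG (Set.mem_Ici.mpr le_rfl) (Set.mem_Ici.mpr hx0) hx0
          have hG1 : G (s i * u ^ 2) ≤ G (1 / c) :=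
            hG (Set.mem_Ici.mpr hx0) (Set.mem_Ici.mpr (hx0.trans hx1)) hx1
          have hGabs : |G (s i * u ^ 2)| ≤ Γ := by
            rw [abs_le]
            constructor
            · have : -Γ ≤ -|G 0| := neg_le_neg (le_max_left _ _)
              exact this.trans ((neg_abs_le _).trans hG0)
            · exact (hG1.trans (le_abs_self _)).trans (le_max_right _ _)
          have h1 : K i * G (s i * u ^ 2) ≤ 1 :=
            calc K i * G (s i * u ^ 2) ≤ |K i * G (s i * u ^ 2)| := le_abs_self _
              _ = |K i| * |G (s i * u ^ 2)| := abs_mul _ _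
              _ ≤ |K i| * Γ := mul_le_mul_of_nonneg_left hGabs (abs_nonneg _)
              _ ≤ 1 := hKi
          have h2 : ∫ ω, Real.exp (u * ω f₀) ∂ν i - Real.exp (u ^ 2 * v / 2) ≤ 1 :=
            (le_abs_self _).trans (hb.trans h1)
          rw [hu, hw2] at h2
          linarith
        have h₁ := herr w rfl
        have h₂ := herr (-w) (by ring)
        -- fourth moment of `ω(f₀)` from the two exponential moments
        have hpt : ∀ x : ℝ, x ^ 4 ≤ 24 / w ^ 4 * (Real.exp (w * x) + Real.exp (-w * x)) := by
          intro x
          have h := pow_four_le_exp_add_exp_neg (w * x)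
          have hw4 : 0 < w ^ 4 := by positivity
          rw [div_mul_eq_mul_div, le_div_iff₀ hw4]
          calc x ^ 4 * w ^ 4 = (w * x) ^ 4 := by ring
            _ ≤ 24 * (Real.exp (w * x) + Real.exp (-(w * x))) := h
            _ = 24 * (Real.exp (w * x) + Real.exp (-w * x)) := by rw [neg_mul]
        have hdom : Integrable (fun ω : FieldConfig E =>
            24 / w ^ 4 * (Real.exp (w * ω f₀) + Real.exp (-w * ω f₀))) (ν i) :=
          ((hinti w).add (hinti (-w))).const_mul _
        have h4int : Integrable (fun ω : FieldConfig E => (ω f₀) ^ 4) (ν i) := by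
          refine hdom.mono' ((measurable_eval f₀).pow_const 4).aestronglyMeasurable
            (Eventually.of_forall fun ω => ?_)
          rw [Real.norm_eq_abs, abs_of_nonneg (by positivity)]
          exact hpt (ω f₀)
        refine ⟨h4int, ?_⟩
        have hw4 : 24 / w ^ 4 = 24 * v ^ 2 := by
          have : w ^ 4 = (w ^ 2) ^ 2 := by ring
          rw [this, hw2', inv_pow, div_eq_mul_inv, inv_inv]
        calc ∫ ω, (ω f₀) ^ 4 ∂ν i
            ≤ ∫ ω, 24 / w ^ 4 * (Real.exp (w * ω f₀) + Real.exp (-w * ω f₀)) ∂ν i :=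
              integral_mono h4int hdom fun ω => hpt (ω f₀)
          _ = 24 * v ^ 2 * (∫ ω, Real.exp (w * ω f₀) ∂ν i + ∫ ω, Real.exp (-w * ω f₀) ∂ν i) := by
              rw [integral_const_mul, integral_add (hinti w) (hinti (-w)), hw4]
          _ ≤ 48 * (Real.exp (1 / 2) + 1) * v ^ 2 := by
              have : 0 ≤ v ^ 2 := sq_nonneg _
              nlinarith)
    refine ⟨V, ?_⟩
    filter_upwards [hPev, hV] with i hPi hVi
    rwa [hPi, integral_map_eval (ν i) f₀ (by fun_prop)] at hVi
  refine ⟨V / c, ?_⟩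
  filter_upwards [hlow, hV] with i hlowi hVi
  rw [le_div_iff₀ hc, mul_comm]
  exact hlowi.trans hVi

/-- **Gaussianity of limits in law from a scale-covariant exponential-moment bound** (the
form in which Aizenman–Duminil-Copin 2021, Prop. 1.4 / 7.2 — as its proof, §6.3, establishes
it — and the lower variance bound of p. 6 present themselves at the level of laws on `𝒮'`
under an unknown field normalisation). Let `ν_i → μ` in law on `𝒮'(E)` (`E` finite
dimensional), `ν_i` probability laws eventually, and let `s_i ≥ 0` be numbers (the squared
ratio between the field normalisation in use and the block-spin normalisation `Σ_L^{-1/2}` of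
print) such that (i) for one compactly supported `f₀` and a `c > 0`, `c s_i ≤ ∫ ω(f₀)² dν_i`
eventually (p. 6: `⟨T_{f,L}²⟩ ≥ c_f`), and (ii) for every compactly supported `f` there are
`K_i → 0` and `G` monotone on `[0, ∞)` with, eventually, all exponential moments of `ω(f)`
finite and `|∫ e^{w ω(f)} dν_i - e^{w² v_i/2}| ≤ K_i G(s_i w²)` for all real `w`
(`v_i = ∫ ω(f)² dν_i`; Prop. 7.2 in proof form reads so with `G(t) = t² e^{Ct/2}`,
`K_i = C ‖f‖_∞⁴ r_f¹² (log L_i)^{-c}`). Then `μ` is Gaussian. The scale is first shown to be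
bounded (`eventually_scale_le_of_tendstoInLaw`), which makes the bound locally uniform in `w`
(`exists_uniform_bound_of_scaleBound`), and `isGaussian_of_tendstoInLaw_of_mgfApprox` applies.
[cite: AizenmanDuminilCopinAnnals2021, Thm 1.2 with Prop. 1.4 / Prop. 7.2 and p. 6] -/
theorem isGaussian_of_tendstoInLaw_of_scaleBound
    (hprob : ∀ᶠ i in l, IsProbabilityMeasure (ν i)) (hlim : TendstoInLaw ν l μ)
    {s : ι → ℝ} (hs : ∀ᶠ i in l, 0 ≤ s i)
    (h₀ : ∃ (f₀ : 𝓢(E, ℝ)) (c : ℝ), HasCompactSupport f₀ ∧ 0 < c ∧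
      ∀ᶠ i in l, c * s i ≤ ∫ ω, (ω f₀) ^ 2 ∂ν i)
    (h : ∀ f : 𝓢(E, ℝ), HasCompactSupport f → ∃ (K : ι → ℝ) (G : ℝ → ℝ),
      Tendsto K l (𝓝 0) ∧ MonotoneOn G (Set.Ici 0) ∧
      (∀ᶠ i in l, ∀ w : ℝ, Integrable (fun ω : FieldConfig E => Real.exp (w * ω f)) (ν i)) ∧
      ∀ᶠ i in l, ∀ w : ℝ,
        |(∫ ω, Real.exp (w * ω f) ∂ν i) - Real.exp (w ^ 2 * (∫ ω, (ω f) ^ 2 ∂ν i) / 2)|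
          ≤ K i * G (s i * w ^ 2)) :
    IsGaussian μ := by
  obtain ⟨f₀, c, hf₀, hc, hlow⟩ := h₀
  obtain ⟨K₀, G₀, hK₀, hG₀, hint₀, hbd₀⟩ := h f₀ hf₀
  obtain ⟨S, hS⟩ := eventually_scale_le_of_tendstoInLaw hprob hlim hs hc hlow hK₀ hG₀ hint₀ hbd₀
  refine isGaussian_of_tendstoInLaw_of_mgfApprox hprob hlim fun f hf => ?_
  obtain ⟨K, G, hK, hG, hint, hbd⟩ := h f hf
  exact ⟨hint, fun W => exists_uniform_bound_of_scaleBound hs hS hK hG hbd W⟩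

end Assembly

/-! ### constructive-qft.S24: `phi44_triviality` from the exponential-moment bound -/

section Phi4

open Literature.Probability.LatticeModels (box invCorrLength)

/-- **`phi44_triviality` from its un-centred form** (restated shape, thermodynamic limit first;
ADC 2021 Thm 1.2): the named fact
`Literature.MathematicalPhysics.QuantumFieldTheory.phi44_triviality` follows from the same
statement with conclusion `ProbabilityTheory.IsGaussian μ` ("is a generalized Gaussian process",
the printed conclusion) in place of `IsGaussianField μ`, centring being automatic
(`isGaussianField_of_isGaussian_phi4_thermodynamicLimit`).
[cite: AizenmanDuminilCopinAnnals2021, Thm 1.2 (p. 4) and §6.3 (p. 26)] -/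
theorem phi44_triviality_of_isGaussian
    (h : ∀ (g κ : ℝ), 0 < g → ∀ (J : ℝ → ℝ) (ρ : ℝ → ℝ)
      (ν : ℝ → Measure (FieldConfig (EuclideanSpace ℝ (Fin 4))))
      (μ : Measure (FieldConfig (EuclideanSpace ℝ (Fin 4)))),
      (∀ δ, 0 < δ → 0 ≤ J δ ∧ J δ ≤ phi4CriticalJ 4 g κ) →
      (∃ M : ℝ, ∀ᶠ δ in 𝓝[>] (0 : ℝ), J δ = phi4CriticalJ 4 g κ ∨
          (0 < J δ ∧ invCorrLength (phi4TwoPoint 4 g κ (J δ)) ≤ M * δ)) →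
      (∀ δ, 0 < δ → TendstoInLaw (fun R : ℕ =>
          latticeFieldLaw (phi4BoxMeasure 4 R g κ (J δ)) (box 4 R) δ (ρ δ)) atTop (ν δ)) →
      TendstoInLaw ν (𝓝[>] 0) μ →
      HasBoundedNondegenerateTwoPoint μ → IsGaussian μ) :
    phi44_triviality := fun g κ hg J ρ ν μ hJ hM hν hlim h2 =>
  isGaussianField_of_isGaussian_phi4_thermodynamicLimit hν hlim
    (h g κ hg J ρ ν μ hJ hM hν hlim h2)

/-- The thermodynamic limits in law `ν_δ` of the free-boundary `φ⁴` box laws (the approximants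
of `phi44_triviality` / `phi4_highDim_triviality` as restated) are probability laws for `δ > 0`
(limits in law along `ℕ` of probability laws, `isProbabilityMeasure_of_tendstoInLaw`).
[folklore] -/
theorem isProbabilityMeasure_phi4_thermodynamicLimit {d : ℕ} {g κ : ℝ} (hg : 0 < g) {J : ℝ → ℝ}
    {ρ : ℝ → ℝ} {ν : ℝ → Measure (FieldConfig (EuclideanSpace ℝ (Fin d)))}
    (hν : ∀ δ, 0 < δ → TendstoInLaw (fun R : ℕ =>
        latticeFieldLaw (phi4BoxMeasure d R g κ (J δ)) (box d R) δ (ρ δ)) atTop (ν δ))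
    {δ : ℝ} (hδ : 0 < δ) : IsProbabilityMeasure (ν δ) := by
  refine isProbabilityMeasure_of_tendstoInLaw (Eventually.of_forall fun R => ?_) (hν δ hδ)
  haveI := isProbabilityMeasure_phi4BoxMeasure d R hg κ (J δ)
  infer_instance

/-- **`phi44_triviality` from the exponential-moment bound of ADC Prop. 7.2 with the lower
variance bound of p. 6, at the level of the thermodynamic-limit laws** (Aizenman–Duminil-Copin
2021: Thm 1.2 is deduced from Prop. 1.4 / Prop. 7.2 by the remark on p. 6, "The claimed
gaussianity follows since … `C r_f² ‖f‖²_∞ ≥ ⟨T_{f,L}²⟩ ≥ c_f > 0` uniformly in `β ≤ β_c`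
and `L`, we get that for `L ≫ 1` the distribution of `T_{f,L}` is approximately Gaussian of
variance `⟨T_{f,L}²⟩`"). The hypothesis `h` is that remark's input, transcribed for the laws
`ν_δ` of the restated `phi44_triviality` (thermodynamic limit in law of the free-boundary box
laws at mesh `δ`, couplings `0 ≤ J(δ) ≤ J_c` inside the window
`J(δ) = J_c ∨ (0 < J(δ) ∧ ξ(J(δ))⁻¹ ≤ M δ)`): there is a scale `s(δ) ≥ 0` — in print
`s(δ) = (ρ(δ) δ⁴)² Σ_{L}(J(δ))`, `L = δ⁻¹`, so that `ω(f) = s(δ)^{1/2} T_{f,L}` — with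
(i) `c s(δ) ≤ ∫ ω(f₀)² dν_δ` eventually for one compactly supported `f₀` (p. 6,
`⟨T_{f₀,L}²⟩ ≥ c_{f₀} > 0`), and (ii) for every compactly supported `f`, constants `K(δ) → 0`
(`C ‖f‖_∞⁴ r_f¹² (log L)^{-c}` inside the window) and `G` monotone on `[0, ∞)` such that
eventually all exponential moments of `ω(f)` under `ν_δ` are finite and
`|∫ e^{w ω(f)} dν_δ - e^{w² v_δ(f)/2}| ≤ K(δ) G(s(δ) w²)` for all real `w`
(`v_δ(f) = ∫ ω(f)² dν_δ = s(δ) ⟨T_{f,L}²⟩`). With `z = s^{1/2} w`, Prop. 7.2 in the form its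
proof (§6.3) establishes — `|⟨e^{z T_{f,L}}⟩ - e^{z²⟨T_{f,L}²⟩/2}| ≤ e^{z²⟨T_{|f|,L}²⟩/2} ·
C ‖f‖_∞⁴ r_f¹² z⁴ (log L)^{-c}`, which for `f ≥ 0` is the printed display (cf. the caveat
recorded at `Literature.Probability.LatticeModels.aizenmanDuminilCopin_mgf_normalizedField_bound`)
— together with the upper bound `⟨T_{|f|,L}²⟩ ≤ C r_f² ‖f‖_∞²` of p. 6 is (ii) with
`G(t) = t² exp(C r_f² ‖f‖_∞² t / 2)`. Given `h`, every limit in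
law `μ` is Gaussian (`isGaussian_of_tendstoInLaw_of_scaleBound`) and centred
(`phi44_triviality_of_isGaussian`); the a-posteriori hypothesis
`HasBoundedNondegenerateTwoPoint μ` of the fact is not needed. What `h` leaves to vendor is
exactly the `φ⁴₄` substance of the source: Prop. 7.2 (from the improved tree diagram bound
Thm 7.1, random currents for the Griffiths–Simon class) and the variance bounds of §5, for the
infinite-volume lattice `φ⁴` state, identified with `ν_δ`.
[cite: AizenmanDuminilCopinAnnals2021, Thm 1.2 (p. 4), Prop. 7.2 (p. 28), p. 6 (display after Prop. 1.4), §6.3 (p. 26)] -/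
theorem phi44_triviality_of_scaleBound
    (h : ∀ (g κ : ℝ), 0 < g → ∀ (J : ℝ → ℝ) (ρ : ℝ → ℝ)
      (ν : ℝ → Measure (FieldConfig (EuclideanSpace ℝ (Fin 4)))),
      (∀ δ, 0 < δ → 0 ≤ J δ ∧ J δ ≤ phi4CriticalJ 4 g κ) →
      (∃ M : ℝ, ∀ᶠ δ in 𝓝[>] (0 : ℝ), J δ = phi4CriticalJ 4 g κ ∨
          (0 < J δ ∧ invCorrLength (phi4TwoPoint 4 g κ (J δ)) ≤ M * δ)) →
      (∀ δ, 0 < δ → TendstoInLaw (fun R : ℕ =>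
          latticeFieldLaw (phi4BoxMeasure 4 R g κ (J δ)) (box 4 R) δ (ρ δ)) atTop (ν δ)) →
      ∃ s : ℝ → ℝ, (∀ᶠ δ in 𝓝[>] (0 : ℝ), 0 ≤ s δ) ∧
        (∃ (f₀ : 𝓢(EuclideanSpace ℝ (Fin 4), ℝ)) (c : ℝ), HasCompactSupport f₀ ∧ 0 < c ∧
          ∀ᶠ δ in 𝓝[>] (0 : ℝ), c * s δ ≤ ∫ ω, (ω f₀) ^ 2 ∂ν δ) ∧
        ∀ f : 𝓢(EuclideanSpace ℝ (Fin 4), ℝ), HasCompactSupport f →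
          ∃ (K : ℝ → ℝ) (G : ℝ → ℝ), Tendsto K (𝓝[>] 0) (𝓝 0) ∧ MonotoneOn G (Set.Ici 0) ∧
            (∀ᶠ δ in 𝓝[>] (0 : ℝ), ∀ w : ℝ,
              Integrable (fun ω : FieldConfig (EuclideanSpace ℝ (Fin 4)) =>
                Real.exp (w * ω f)) (ν δ)) ∧
            ∀ᶠ δ in 𝓝[>] (0 : ℝ), ∀ w : ℝ,
              |(∫ ω, Real.exp (w * ω f) ∂ν δ) -
                  Real.exp (w ^ 2 * (∫ ω, (ω f) ^ 2 ∂ν δ) / 2)| ≤ K δ * G (s δ * w ^ 2)) :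
    phi44_triviality := by
  refine phi44_triviality_of_isGaussian fun g κ hg J ρ ν μ hJ hM hν hlim _ => ?_
  obtain ⟨s, hs, h₀, hf⟩ := h g κ hg J ρ ν hJ hM hν
  have hprob : ∀ᶠ δ in 𝓝[>] (0 : ℝ), IsProbabilityMeasure (ν δ) :=
    (eventually_mem_nhdsWithin (a := (0 : ℝ)) (s := Set.Ioi 0)).mono fun δ hδ =>
      isProbabilityMeasure_phi4_thermodynamicLimit hg hν hδ
  exact isGaussian_of_tendstoInLaw_of_scaleBound hprob hlim hs h₀ hf

end Phi4

/-! ### constructive-qft.S24, `d ≥ 5`: `phi4_highDim_triviality` from the exponential-moment bound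

Appendix (same seat, 2026-08-15). The restated `phi4_highDim_triviality` (Aizenman 1982,
Prop. 10.1; Panis 2023, Thm 5.5 with Rem. 5.7, `d ≥ 5`) has the same shape as the restated
`phi44_triviality` — thermodynamic limit in law first, then `δ → 0⁺` — with the window replaced
by `J(δ) ≥ J₀ > 0` eventually; its printed quantitative input, Panis's Thm 5.5
`|⟨e^{z T_{f,L,β}}⟩ - e^{z²⟨T²_{f,L,β}⟩/2}| ≤ e^{z²⟨T²_{|f|,L,β}⟩/2} C (β⁻⁴ ∨ β⁻²) ‖f‖_∞⁴ r_f^γ z⁴ / L^{d-4}`,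
is again of the scale-covariant form `K G(s w²)` with `G(t) = t² e^{C_f t/2}` once
`⟨T²_{|f|,L,β}⟩ ≤ C_f` (Panis §1.2.1, fn. 3), so `isGaussian_of_tendstoInLaw_of_scaleBound`
reduces that fact in the same way (`phi4_highDim_triviality_of_scaleBound`, through the centring
reduction `phi4_highDim_triviality_of_isGaussian` of `ContinuumLimitsTrivialityProofs`).
-/

section Phi4HighDim

open Literature.Probability.LatticeModels (box)

/-- **`phi4_highDim_triviality` (`d ≥ 5`) from the exponential-moment bound of Panis 2023,
Thm 5.5 (Aizenman 1982 / Fröhlich 1982 in correlation-function form) with the variance bounds,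
at the level of the thermodynamic-limit laws.** The hypothesis `h` transcribes, for the laws
`ν_δ` of the restated fact (thermodynamic limit in law of the free-boundary box laws at mesh `δ`,
`d ≥ 5`, `g > 0`, couplings `0 ≤ J(δ) ≤ J_c` with `J(δ) ≥ J₀ > 0` eventually), the printed
input "for `β ≤ β_c`, every sub-sequential scaling limit of the model is Gaussian" is deduced
from: a scale `s(δ) ≥ 0` (`(ρ(δ) δᵈ)² Σ_L(J(δ))`, `L = δ⁻¹`, so that `ω(f) = s^{1/2} T_{f,L}`)
with (i) `c s(δ) ≤ ∫ ω(f₀)² dν_δ` eventually for one compactly supported `f₀` (Panis §1.2.1,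
fn. 3: `⟨T²_{f,L,β}⟩ ≥ c_f > 0`), and (ii) for every compactly supported `f`, `K(δ) → 0`
(`C (β⁻⁴ ∨ β⁻²) ‖f‖_∞⁴ r_f^γ L^{-(d-4)}`, bounded constant thanks to `J ≥ J₀`) and `G` monotone
on `[0, ∞)` (`G(t) = t² exp(C_f t/2)` from the prefactor `e^{z²⟨T²_{|f|,L,β}⟩/2}` and
`⟨T²_{|f|,L,β}⟩ ≤ C_f`) with, eventually, all exponential moments of `ω(f)` under `ν_δ` finite
and `|∫ e^{w ω(f)} dν_δ - e^{w² v_δ(f)/2}| ≤ K(δ) G(s(δ) w²)` for all real `w`. Given `h`, every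
limit in law is Gaussian (`isGaussian_of_tendstoInLaw_of_scaleBound`) and centred
(`phi4_highDim_triviality_of_isGaussian`); `HasBoundedNondegenerateTwoPoint μ` is not used. What
`h` leaves to vendor is the lattice-`φ⁴` substance (Panis Thm 5.5 via Prop. 2.2, Prop. 3.8;
Aizenman §11–13) for the infinite-volume state, identified with `ν_δ`.
[cite: Panis2023Triviality, Thm. 5.5 with Rem. 5.7 and §1.2.1 fn. 3] -/
theorem phi4_highDim_triviality_of_scaleBound
    (h : ∀ (d : ℕ), 5 ≤ d → ∀ (g κ : ℝ), 0 < g → ∀ (J : ℝ → ℝ) (ρ : ℝ → ℝ)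
      (ν : ℝ → Measure (FieldConfig (EuclideanSpace ℝ (Fin d)))),
      (∀ δ, 0 < δ → 0 ≤ J δ ∧ J δ ≤ phi4CriticalJ d g κ) →
      (∃ J₀ : ℝ, 0 < J₀ ∧ ∀ᶠ δ in 𝓝[>] (0 : ℝ), J₀ ≤ J δ) →
      (∀ δ, 0 < δ → TendstoInLaw (fun R : ℕ =>
          latticeFieldLaw (phi4BoxMeasure d R g κ (J δ)) (box d R) δ (ρ δ)) atTop (ν δ)) →
      ∃ s : ℝ → ℝ, (∀ᶠ δ in 𝓝[>] (0 : ℝ), 0 ≤ s δ) ∧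
        (∃ (f₀ : 𝓢(EuclideanSpace ℝ (Fin d), ℝ)) (c : ℝ), HasCompactSupport f₀ ∧ 0 < c ∧
          ∀ᶠ δ in 𝓝[>] (0 : ℝ), c * s δ ≤ ∫ ω, (ω f₀) ^ 2 ∂ν δ) ∧
        ∀ f : 𝓢(EuclideanSpace ℝ (Fin d), ℝ), HasCompactSupport f →
          ∃ (K : ℝ → ℝ) (G : ℝ → ℝ), Tendsto K (𝓝[>] 0) (𝓝 0) ∧ MonotoneOn G (Set.Ici 0) ∧
            (∀ᶠ δ in 𝓝[>] (0 : ℝ), ∀ w : ℝ,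
              Integrable (fun ω : FieldConfig (EuclideanSpace ℝ (Fin d)) =>
                Real.exp (w * ω f)) (ν δ)) ∧
            ∀ᶠ δ in 𝓝[>] (0 : ℝ), ∀ w : ℝ,
              |(∫ ω, Real.exp (w * ω f) ∂ν δ) -
                  Real.exp (w ^ 2 * (∫ ω, (ω f) ^ 2 ∂ν δ) / 2)| ≤ K δ * G (s δ * w ^ 2)) :
    phi4_highDim_triviality := by
  refine phi4_highDim_triviality_of_isGaussian fun d hd g κ hg J ρ ν μ hJ hJ₀ hν hlim _ => ?_
  obtain ⟨s, hs, h₀, hf⟩ := h d hd g κ hg J ρ ν hJ hJ₀ hν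
  have hprob : ∀ᶠ δ in 𝓝[>] (0 : ℝ), IsProbabilityMeasure (ν δ) :=
    (eventually_mem_nhdsWithin (a := (0 : ℝ)) (s := Set.Ioi 0)).mono fun δ hδ =>
      isProbabilityMeasure_phi4_thermodynamicLimit hg hν hδ
  exact isGaussian_of_tendstoInLaw_of_scaleBound hprob hlim hs h₀ hf

end Phi4HighDim

end Literature.MathematicalPhysics.QuantumFieldTheory

end
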